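import Literature.Probability.RandomPlanarGeometry.PolylineVertexToCurve
import HarnessLib

/-!
# Stub `stub_vertexToCurve` of the line `reversal-virgin-disc` (crux `HexTight`, stmt-CriticalPhenomena-5423)

Landing target `Summits/CriticalPhenomena/SAWScalingLimit/Theorems/SAWDevelopingMapHexTightVertexToCurve.lean`.
WHAT: the VERTEX-TO-CURVE dictionary entry of the line (`VertexToCurve` in the skeleton
`Cruxes/HexTight/Lines/reversal_virgin_disc.lean`): if a list of points `l` of the plane has `k` WEAK
vertex traversals of the shell `D(x; r, R)` (indices `ι m ≤ κ m` whose points lie on opposite sides,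
`κ m ≤ ι m'` for `m < m'` — consecutive traversals may share a vertex), then the polyline through `l`
traverses every STRICTLY shrunk shell `D(x; r', R')`, `r < r' < R' < R`, by `k` SEPARATE segments
(`Curve.HasTraversals`, Aizenman–Burchard's event). HOW: this is the planar instance of the Literature
theorem `hasTraversals_polyline_of_vertexTraversals` (`PolylineVertexToCurve.lean`: the vertices are
visited in order at increasing times, and each traversal is re-timed strictly inside its vertex interval
by two applications of the intermediate value theorem).
-/

noncomputable section

open Literature.Probability.LatticeModels Literature.Probability.RandomPlanarGeometry

namespace Summit.CriticalPhenomena.SAWScalingLimit.Theorems.HexTight.Reversal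

/-- **stub A — VERTEX-TO-CURVE** of the line `reversal-virgin-disc`: `k` weak vertex traversals of
`D(x; r, R)` by a list of points of `ℂ` give `k` separate traversals of every strictly shrunk shell
`D(x; r', R')`, `r < r' < R' < R`, by the polyline through the list (the planar case of
`Literature.Probability.RandomPlanarGeometry.hasTraversals_polyline_of_vertexTraversals`). -/
theorem stub_vertexToCurve :
    ∀ (l : List ℂ) (k : ℕ) (x : ℂ) (r r' R' R : ℝ), r < r' → r' < R' → R' < R →
      (∃ ι κ : Fin k → Fin l.length, (∀ m, ι m ≤ κ m) ∧
        (∀ m, (dist (l.get (ι m)) x ≤ r ∧ R ≤ dist (l.get (κ m)) x) ∨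
          (R ≤ dist (l.get (ι m)) x ∧ dist (l.get (κ m)) x ≤ r)) ∧
        ∀ ⦃m m'⦄, m < m' → κ m ≤ ι m') →
      (⟨polyline l⟩ : Curve ℂ).HasTraversals k x r' R' :=
  fun _ _ _ _ _ _ _ h₁ h₂ h₃ h => hasTraversals_polyline_of_vertexTraversals h₁ h₂ h₃ h

end Summit.CriticalPhenomena.SAWScalingLimit.Theorems.HexTight.Reversal

end
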